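/-
Copyright: the b2b-balaban T⁴-continuum CRUX team, row NE7b OWNER lineage `t4-ne7b-p1` (gen 145). Project licence.
-/
import Mathlib

/-!
# WEIGHTED TWO-POINT MASTERS — ABSTRACT FAMILIES (SCOPING-d17 (R-c), the toolbox for the weighted output letters at every order).
# Every two-point term of the entry majorants `M₃, M₄, M₅` ((479), (526), (610)) has the shape `E_D(b_r, a) = Σ_w(Dᵀb_r)_w(Dᵀa)_w∕(1−lamA)` with
# ONE profile `a : κ → ℝ` attached to the fixed (anchor) index and a FAMILY `b_r` indexed by the summed display indices `r ∈ R` (single sites,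
# pairs, triples — a finite type).  (480)∕(527)'s plain masters bound `Σ_r E_D(b_r,a)` by `(Σa)·(column letter of the family)·dr·dc∕(1−lamA)`.
# The weighted class sums `Σ_r E_D(b_r,a)·ϑ_r` against a site weight `ϑ_r` from the anchor to `r`; THIS FILE is the weighted master, for
# abstract weights: `ϑ_r ≤ σ_w·σ′_{rw}` (route through the sampler index `w` of `E_D`), `σ_w ≤ σ₁_{z′}θ_{z′w}` and `σ′_{rw} ≤ σ′₁_{rz′}θ_{z′w}`
# (the class's `hσθ`), `D`'s weighted letters `dθ, dθ′` against `θ`, the anchor profile's weighted letter `Σ_{z′}a_{z′}σ₁_{z′} ≤ αa` and the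
# family's weighted COLUMN letter `Σ_r b_{rz′}σ′₁_{rz′} ≤ αfc` (uniform in `z′`):
#   `Σ_r E_D(b_r,a)·ϑ_r ≤ dθ·αa·(dθ′·αfc)∕(1−lamA)`   (both orientations of the product),
# (652)'s order-2 letters being the instance `R = ι`, `b_r = b^r`, `a = b^v` (row NE7b, node U5c; Mathlib only; [folklore]).  The instances at
# orders 3–5 take `R = ι`, `ι × ι`, `ι × ι × ι` (the `K3`-, `K4`-vector families, `Fintype.sum_prod_type`) with the family column letters
# supplied from the intrinsic weighted letters by (651)'s transport.

Cell `pub-balaban`, sub-cell `t4`, spine estimate NE7b (`T4WeightBudget.RelWeightBound`; the cell's OWN estimate — NOT PRINTED in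
[Bałaban 1983–89], NOT PROVED).  Crux-route work under `Spine/NE7b/` by the row OWNER (`t4-ne7b-p1` gen 145, file (653)) under FREEZE
(0)'s crux-prover clause; NOTHING of Bałaban's is named as a Lean object, valued or asserted; no `T4Continuum/Support` leaf typed; no
`def`, no notation; zero `sorry`.  Imports: Mathlib only.

WHAT IS PROVED ([folklore]): §1 `transported_anchor_le` (`Σ_w(Dᵀa)_wσ_w ≤ dθ·αa`), `transported_family_le` (`Σ_r(Dᵀb_r)_wσ′_{rw} ≤ dθ′·αfc`);
§2 THE ENDS **`weighted_two_point_family_le`** (family factor first), **`weighted_two_point_family_le'`** (anchor factor first); §3 toy.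

HONEST (what this is NOT).  Abstract bookkeeping; the instances (weighted output letters of `K3⁺, K4⁺, K5⁺`), the cumulant-tree and
interpolated terms' weighted star sums and the rate bookkeeping are the next files; scalar skeleton ((A3), NC-NE7b-α UNRULED); nothing of
Bałaban's asserted.  BY-NAME EFFECT ON THE WALL: NONE.  NE7b NOT PRINTED ∕ NOT PROVED; spine PROVED 0∕9; rung (B)+1 — the programme's
measures remain FINITE-torus statements; NOT the mass gap, NOT Clay.  HONEST DEPENDENCY: continuum YM on T⁴ ⇐ BetaPertH ∧ nine spine
estimates (0∕9 proved); BetaPertH ⇐ (D1) ∧ (D4) ∧ CAP+tail; G-an2-4 gates asym, D1 and NE2∕3∕4.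
-/

set_option autoImplicit false

noncomputable section

namespace Summit.QuantumFields.BalabanUV.T4Continuum.NE7b.SupWeightedTwoPointMasters

open Finset Real
open scoped BigOperators

variable {κ R : Type} [Fintype κ] [Fintype R]

variable {D : κ → κ → ℝ} {θ : κ → κ → ℝ} {a σ σ₁ : κ → ℝ} {b σ' σ'₁ : R → κ → ℝ} {ϑ : R → ℝ} {lamA dθ dθ' αa αfc : ℝ}

/-! ## §1. The transported profiles -/

omit [Fintype R] in
/-- **The anchor profile transported**: `Σ_w (Dᵀa)_w·σ_w ≤ dθ·αa`. [folklore] -/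
theorem transported_anchor_le (ha0 : ∀ z', 0 ≤ a z') (hD : ∀ x y, 0 ≤ D x y) (hσ₁0 : ∀ z', 0 ≤ σ₁ z')
    (hσθ : ∀ z' w, σ w ≤ σ₁ z' * θ z' w) (hDr : ∀ z', ∑ w, D z' w * θ z' w ≤ dθ) (hdθ : 0 ≤ dθ) (haσ : ∑ z', a z' * σ₁ z' ≤ αa) :
    ∑ w, (∑ z', D z' w * a z') * σ w ≤ dθ * αa := by
  calc ∑ w, (∑ z', D z' w * a z') * σ w
      ≤ ∑ w, ∑ z', D z' w * θ z' w * (a z' * σ₁ z') := by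
        refine sum_le_sum fun w _ => ?_
        rw [sum_mul]
        refine sum_le_sum fun z' _ => ?_
        calc D z' w * a z' * σ w ≤ D z' w * a z' * (σ₁ z' * θ z' w) := mul_le_mul_of_nonneg_left (hσθ z' w) (mul_nonneg (hD z' w) (ha0 z'))
          _ = D z' w * θ z' w * (a z' * σ₁ z') := by ring
    _ = ∑ z', (∑ w, D z' w * θ z' w) * (a z' * σ₁ z') := by
        rw [sum_comm]; exact sum_congr rfl fun z' _ => (Finset.sum_mul _ _ _).symm
    _ ≤ ∑ z', dθ * (a z' * σ₁ z') := sum_le_sum fun z' _ => mul_le_mul_of_nonneg_right (hDr z') (mul_nonneg (ha0 z') (hσ₁0 z'))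
    _ = dθ * ∑ z', a z' * σ₁ z' := by rw [mul_sum]
    _ ≤ dθ * αa := mul_le_mul_of_nonneg_left haσ hdθ

/-- **The family transported, uniformly in the sampler index**: `Σ_r (Dᵀb_r)_w·σ′_{rw} ≤ dθ′·αfc`. [folklore] -/
theorem transported_family_le (hb0 : ∀ r z', 0 ≤ b r z') (hD : ∀ x y, 0 ≤ D x y) (hθnn : ∀ z w, 0 ≤ θ z w)
    (hσθ' : ∀ r z' w, σ' r w ≤ σ'₁ r z' * θ z' w) (hDc : ∀ w, ∑ z', D z' w * θ z' w ≤ dθ')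
    (hfc : ∀ z', ∑ r, b r z' * σ'₁ r z' ≤ αfc) (hαfc : 0 ≤ αfc) (w : κ) :
    ∑ r, (∑ z', D z' w * b r z') * σ' r w ≤ dθ' * αfc := by
  calc ∑ r, (∑ z', D z' w * b r z') * σ' r w
      ≤ ∑ r, ∑ z', D z' w * θ z' w * (b r z' * σ'₁ r z') := by
        refine sum_le_sum fun r _ => ?_
        rw [sum_mul]
        refine sum_le_sum fun z' _ => ?_
        calc D z' w * b r z' * σ' r w ≤ D z' w * b r z' * (σ'₁ r z' * θ z' w) := mul_le_mul_of_nonneg_left (hσθ' r z' w) (mul_nonneg (hD z' w) (hb0 r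
            z'))
          _ = D z' w * θ z' w * (b r z' * σ'₁ r z') := by ring
    _ = ∑ z', D z' w * θ z' w * ∑ r, b r z' * σ'₁ r z' := by
        rw [sum_comm]; exact sum_congr rfl fun z' _ => by rw [mul_sum]
    _ ≤ ∑ z', D z' w * θ z' w * αfc := sum_le_sum fun z' _ => mul_le_mul_of_nonneg_left (hfc z') (mul_nonneg (hD z' w) (hθnn z' w))
    _ = (∑ z', D z' w * θ z' w) * αfc := by rw [sum_mul]
    _ ≤ dθ' * αfc := mul_le_mul_of_nonneg_right (hDc w) hαfc

/-! ## §2. THE ENDS: the weighted two-point family sums -/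

/-- **THE WEIGHTED TWO-POINT MASTER** (family factor first): `Σ_r E_D(b_r,a)·ϑ_r ≤ dθ·αa·(dθ′·αfc)∕(1−lamA)`, routing `ϑ_r ≤ σ_w·σ′_{rw}`
through the sampler index. [folklore] -/
theorem weighted_two_point_family_le (ha0 : ∀ z', 0 ≤ a z') (hb0 : ∀ r z', 0 ≤ b r z') (hD : ∀ x y, 0 ≤ D x y) (hθnn : ∀ z w, 0 ≤ θ z w)
    (hσ0 : ∀ w, 0 ≤ σ w) (hσ₁0 : ∀ z', 0 ≤ σ₁ z') (hϑ : ∀ r w, ϑ r ≤ σ w * σ' r w) (hσθ : ∀ z' w, σ w ≤ σ₁ z' * θ z' w)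
    (hσθ' : ∀ r z' w, σ' r w ≤ σ'₁ r z' * θ z' w) (hDr : ∀ z', ∑ w, D z' w * θ z' w ≤ dθ) (hdθ : 0 ≤ dθ)
    (hDc : ∀ w, ∑ z', D z' w * θ z' w ≤ dθ') (hdθ' : 0 ≤ dθ') (haσ : ∑ z', a z' * σ₁ z' ≤ αa) (hfc : ∀ z', ∑ r, b r z' * σ'₁ r z' ≤ αfc)
    (hαfc : 0 ≤ αfc) (hlamA1 : lamA < 1) :
    ∑ r, (∑ w, (∑ z', D z' w * b r z') * (∑ z', D z' w * a z') / (1 - lamA)) * ϑ r ≤ dθ * αa * (dθ' * αfc) / (1 - lamA) := by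
  have hl : 0 < 1 - lamA := by linarith
  have hP0 : ∀ (r : R) (w : κ), 0 ≤ ∑ z', D z' w * b r z' := fun r w => sum_nonneg fun z' _ => mul_nonneg (hD z' w) (hb0 r z')
  have hQ0 : ∀ w : κ, 0 ≤ ∑ z', D z' w * a z' := fun w => sum_nonneg fun z' _ => mul_nonneg (hD z' w) (ha0 z')
  have h1 : ∑ r, (∑ w, (∑ z', D z' w * b r z') * (∑ z', D z' w * a z') / (1 - lamA)) * ϑ r ≤
      ∑ r, ∑ w, ((∑ z', D z' w * a z') * σ w) * (((∑ z', D z' w * b r z') * σ' r w) / (1 - lamA)) := by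
    refine sum_le_sum fun r _ => ?_
    rw [sum_mul]
    refine sum_le_sum fun w _ => ?_
    rw [div_mul_eq_mul_div, ← mul_div_assoc]
    refine div_le_div_of_nonneg_right ?_ hl.le
    calc (∑ z', D z' w * b r z') * (∑ z', D z' w * a z') * ϑ r ≤ (∑ z', D z' w * b r z') * (∑ z', D z' w * a z') * (σ w * σ' r w) :=
          mul_le_mul_of_nonneg_left (hϑ r w) (mul_nonneg (hP0 r w) (hQ0 w))
      _ = (∑ z', D z' w * a z') * σ w * ((∑ z', D z' w * b r z') * σ' r w) := by ring
  refine h1.trans ?_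
  rw [sum_comm]
  calc ∑ w, ∑ r, (∑ z', D z' w * a z') * σ w * ((∑ z', D z' w * b r z') * σ' r w / (1 - lamA))
      = ∑ w, (∑ z', D z' w * a z') * σ w * ((∑ r, (∑ z', D z' w * b r z') * σ' r w) / (1 - lamA)) :=
        sum_congr rfl fun w _ => by rw [← mul_sum, ← sum_div]
    _ ≤ ∑ w, (∑ z', D z' w * a z') * σ w * (dθ' * αfc / (1 - lamA)) :=
        sum_le_sum fun w _ => mul_le_mul_of_nonneg_left
          (div_le_div_of_nonneg_right (transported_family_le hb0 hD hθnn hσθ' hDc hfc hαfc w) hl.le) (mul_nonneg (hQ0 w) (hσ0 w))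
    _ = (∑ w, (∑ z', D z' w * a z') * σ w) * (dθ' * αfc / (1 - lamA)) := by rw [sum_mul]
    _ ≤ dθ * αa * (dθ' * αfc / (1 - lamA)) :=
        mul_le_mul_of_nonneg_right (transported_anchor_le ha0 hD hσ₁0 hσθ hDr hdθ haσ) (div_nonneg (mul_nonneg hdθ' hαfc) hl.le)
    _ = dθ * αa * (dθ' * αfc) / (1 - lamA) := by ring

/-- **THE WEIGHTED TWO-POINT MASTER** (anchor factor first): the same bound for `Σ_r (Σ_w (Dᵀa)_w(Dᵀb_r)_w∕(1−lamA))·ϑ_r`. [folklore] -/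
theorem weighted_two_point_family_le' (ha0 : ∀ z', 0 ≤ a z') (hb0 : ∀ r z', 0 ≤ b r z') (hD : ∀ x y, 0 ≤ D x y) (hθnn : ∀ z w, 0 ≤ θ z w)
    (hσ0 : ∀ w, 0 ≤ σ w) (hσ₁0 : ∀ z', 0 ≤ σ₁ z') (hϑ : ∀ r w, ϑ r ≤ σ w * σ' r w) (hσθ : ∀ z' w, σ w ≤ σ₁ z' * θ z' w)
    (hσθ' : ∀ r z' w, σ' r w ≤ σ'₁ r z' * θ z' w) (hDr : ∀ z', ∑ w, D z' w * θ z' w ≤ dθ) (hdθ : 0 ≤ dθ)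
    (hDc : ∀ w, ∑ z', D z' w * θ z' w ≤ dθ') (hdθ' : 0 ≤ dθ') (haσ : ∑ z', a z' * σ₁ z' ≤ αa) (hfc : ∀ z', ∑ r, b r z' * σ'₁ r z' ≤ αfc)
    (hαfc : 0 ≤ αfc) (hlamA1 : lamA < 1) :
    ∑ r, (∑ w, (∑ z', D z' w * a z') * (∑ z', D z' w * b r z') / (1 - lamA)) * ϑ r ≤ dθ * αa * (dθ' * αfc) / (1 - lamA) := by
  have e : ∀ r, ∑ w, (∑ z', D z' w * a z') * (∑ z', D z' w * b r z') / (1 - lamA) =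
      ∑ w, (∑ z', D z' w * b r z') * (∑ z', D z' w * a z') / (1 - lamA) := fun r => sum_congr rfl fun w _ => by rw [mul_comm]
  simp_rw [e]
  exact weighted_two_point_family_le ha0 hb0 hD hθnn hσ0 hσ₁0 hϑ hσθ hσθ' hDr hdθ hDc hdθ' haσ hfc hαfc hlamA1

/-! ## §3. Toy -/

/-- Toy (a pair family is a family: `Fintype.sum_prod_type` flattens `Σ_yΣ_z` to `Σ_{(y,z)}`). -/
example (f : Fin 2 → Fin 2 → ℝ) : ∑ p : Fin 2 × Fin 2, f p.1 p.2 = ∑ y, ∑ z, f y z := Fintype.sum_prod_type _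

end Summit.QuantumFields.BalabanUV.T4Continuum.NE7b.SupWeightedTwoPointMasters

end
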